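import Summits.QuantumFields.BalabanUV.Gaps.EndRunwiseShooting

/-!
# Gaps / EndRunwiseCone — THEOREM 2's β-HYPOTHESIS IN ITS INDUCTIVE FORM: β-bounds on the RUNNING CONE only (histories already obeying the
# discrete (0.31)), the SIGN on NON-DECREASING histories only, and the tree's ∕ g1-plan-2's partial-sum currencies as COROLLARIES of the run-wise form
# (cell pub-balaban-gaps, seat g1-p3 gen 6, row CAP+tail ∕ β-currency «split ∕ weakening»; sequel of `Gaps/EndRunwiseShooting`)

HONEST FRAMING (cell rule, page 1 of everything): [folklore] real analysis over the tree's typed carriers (`FlowStep.Y` ∕ `gClamp`, `RGEqH`,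
`DagBinding.ForwardGenerated`, `DagBinding.EndpointExistence`, `B12.Thm2Printed`).  [I] Thm 2 is UNPROVED in print (p. 259 «will be given in a
separate paper»; [Balaban1989LargeFieldII] p. 355 «has not been published yet»): `B12.Thm2Printed` ∕ `EndpointExistence` appear below ONLY as
CONCLUSION SHAPES of reductions whose β-side hypotheses (bounds on the running cone, the cone sign, continuity) are BINDERS supplied by no
printed source except the upper bound (p. 264).  NOTHING of Bałaban's is asserted; 0∕6 binders of the T⁴ headline discharged; 0 coefficients
certified; one finite T⁴; NOT B12 Thm 2, NOT `BetaPertH`, NOT the continuum limit, NOT Clay.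
HONEST DEPENDENCY (b2b cell, verbatim): «continuum YM on T⁴ ⇐ BetaPertH ∧ nine spine estimates (0/9 proved); BetaPertH ⇐ (D1) ∧ (D4) ∧
CAP+tail; G-an2-4 gates asym, D1 and NE2/3/4.»

THE POINT.  Every shooting theorem of the tree (`FlowStep.couplingTrajectory_exists_hist`, `FlowStepRuns.regimeRun_exists` ∕
`thm2Printed_of_boxBoundsH` ∕ `endpointExistence_of_partialSums`, `DagBinding.endpointExistence_of_forwardGenerated`) asks its β-bounds on the
WHOLE BOX `]0,γ]^{k+1}` of histories.  An inductive proof of Theorem 2 would deliver less and needs less: at step `k` the history `(g_0,…,g_k)`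
ALREADY obeys the two-sided running `b ≤ 1∕g_j² − 1∕g_{j+1}² ≤ β′` (`j < k`) — the discrete (0.31) up to `k` — and only on such histories
(the RUNNING CONE) must `b ≤ β_{k+1}(g_0,…,g_k) ≤ β′` be known.  With the sup form of the shooting argument (`EndRunwiseShooting.shooting_dichotomy`,
which needs NO β-bound to run) this weaker hypothesis suffices verbatim:
* §1 — the tree's all-history (PS) implies the run-wise (PS) (`runwisePS_of_betaPartialSumsLowerH`, so :593 = the run-wise END composed with
  it), and g1-plan-2's «(PS) along shooting trajectories» gives the END (`endpointExistence_of_shootingPS`); run-wise NECESSITY in the same class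
  for comparison (`windowSum_eq_of_run`).
* §2 — **CONE BOUNDS PROPAGATE ALONG RUNS** (`coneBounds_along_run`): if `b ≤ β_{k+1} ≤ β′` on the running cone, then along EVERY in-interval
  solution of (0.20) the bounds hold at every step (induction: the run's own (0.20) puts its prefixes in the cone).
* §3 — **THEOREM 2 FROM CONE BOUNDS** (`couplingTrajectory_exists_of_coneBounds`, `thm2Printed_of_coneBoundsH`): `0 ≤ b ≤ β′`, joint continuity
  on the boxes (printed smoothness, p. 263–264) and the bounds on the running cone ONLY ⟹ for every `K` and `g ∈ ]0,γ]` an in-interval run of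
  (0.20) ending at `g_K = g`, non-decreasing, with the discrete (0.31); hence `B12.Thm2Printed C L` (`b > 0`) ∕ `EndpointExistence C` (`b = 0`,
  `g⋆ = γ`) for every construction generated forward by (0.20) with `β`; the tree's box forms (:211, :176) are the case «cone := box»
  (`coneBounds_of_boxBounds`).  (Seed: the trial coupling `(1∕g² + β′K)^{−1∕2}` survives by the cone's upper bound propagated along its own
  run; touch: a run sitting at `γ` cannot end below `g` because `β ≥ b ≥ 0` along runs.)
* §4 — **THE SIGN ON NON-DECREASING HISTORIES** (`endpointExistence_of_monotoneSign`): `β_{k+1}(g_0,…,g_k) ≥ 0` asked ONLY where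
  `g_0 ≤ g_1 ≤ … ≤ g_k ≤ γ₀`, + the printed upper bound + continuity on the boxes ⟹ the END binder with `g⋆ = γ` — versus the whole-box sign of
  `DagBinding.endpointExistence_of_forwardGenerated`.
RELEVANCE: `EndpointExistence D.C.toB12` is the β-binder `hEnd` of `T4ContinuumYM4Torus.continuumYM4_torus_of_endpointExistence` and
`B12.Thm2Printed` is [I] Thm 2 AS PRINTED (rows CAP ∕ tail); both now follow from β-information on the running cone alone — the set of histories
an inductive construction actually visits — so every (D1)∕(D4)∕CAP+tail certificate may be CONE-RESTRICTED without loss.  Whether Bałaban's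
inductive bounds on `β_{k+1}` ((2.12)–(2.14) p. 268, §5) use the running of the earlier couplings is NOT asserted here either way.
0 sorry; 0 def; imports `Gaps/EndRunwiseShooting` only; restates nothing.

CITATION HEADER (tags CONTEXT ONLY).  [I] = T. Bałaban, Commun. Math. Phys. **109** (1987) [Balaban1987RG1]: Thm 2 ∕ (0.31) p. 259,
(0.17)–(0.20) pp. 255–256, §1 pp. 263–264, §5 p. 298.
-/

namespace Summit.QuantumFields.BalabanUV.Gaps.EndRunwiseCone

open Literature.MathematicalPhysics.QuantumFieldTheory.Balaban1983to89
open Literature.MathematicalPhysics.QuantumFieldTheory.Balaban1983to89.FlowStep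
open Literature.MathematicalPhysics.QuantumFieldTheory.Balaban1983to89.FlowStepRuns
open Literature.MathematicalPhysics.QuantumFieldTheory.Balaban1983to89.DagBinding
open Summit.QuantumFields.BalabanUV.Gaps.EndRunwiseShooting
open Filter Topology Finset

noncomputable section

variable {β : HBeta} {γ : ℝ}

/-! ## §1 The tree's and g1-plan-2's partial-sum currencies as corollaries of the run-wise form; run-wise necessity for comparison -/

/-- The tree's all-history (PS) `FlowStepRuns.BetaPartialSumsLowerH M γ β` IMPLIES the run-wise (PS) (runs are histories; a run given up to
`n` is extended by the constant `γ` beyond `n`, which the windows `[k,n)` do not see) — so `FlowStepRuns.endpointExistence_of_partialSums`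
(:593) is `EndRunwiseShooting.endpointExistence_of_runwisePS` composed with this lemma (not restated here: the tree's statement stands). [folklore] -/
theorem runwisePS_of_betaPartialSumsLowerH {M : ℝ} (hγ : 0 < γ) (hps : BetaPartialSumsLowerH M γ β) :
    ∀ (n : ℕ) (gs : ℕ → ℝ), RGEqH n β gs → Step.InInterval γ n gs →
      ∀ k, k ≤ n → -M ≤ ∑ j ∈ Finset.Ico k n, β j (prefixOf gs j) := by
  intro n gs _ hI k hk
  classical
  set g' : ℕ → ℝ := fun i => if i ≤ n then gs i else γ with hg'
  have hg'mem : ∀ i, 0 < g' i ∧ g' i ≤ γ := by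
    intro i
    by_cases hi : i ≤ n
    · simp only [hg', hi, if_true]; exact hI i hi
    · simp only [hg', hi, if_false]; exact ⟨hγ, le_rfl⟩
  have h := hps g' hg'mem k n hk
  have hcongr : ∑ j ∈ Finset.Ico k n, β j (prefixOf g' j) = ∑ j ∈ Finset.Ico k n, β j (prefixOf gs j) := by
    refine Finset.sum_congr rfl fun j hj => ?_
    have hjn : j < n := (Finset.mem_Ico.mp hj).2
    congr 1
    funext i
    have hi : (i : ℕ) ≤ n := ((Nat.lt_succ_iff.mp i.isLt).trans hjn.le)
    simp [prefixOf, hg', hi]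
  rwa [hcongr] at h

/-- g1-plan-2's INTERMEDIATE currency «(PS) along all SHOOTING trajectories» (the histories `j ↦ ĝ(Y_j(g₀))`, `g₀ ∈ ]0,γ]`, which is all
that :515 actually feeds to (PS)) IMPLIES the run-wise (PS): an in-interval run is the unclamped shooting trajectory from its own `g_0`
(`Y_eq_of_run`). [folklore] -/
theorem runwisePS_of_shootingPS {M : ℝ}
    (hshoot : ∀ g₀ : ℝ, 0 < g₀ → g₀ ≤ γ → ∀ k n, k ≤ n → -M ≤ ∑ j ∈ Finset.Ico k n, β j (clampPrefix β γ j g₀)) :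
    ∀ (n : ℕ) (gs : ℕ → ℝ), RGEqH n β gs → Step.InInterval γ n gs →
      ∀ k, k ≤ n → -M ≤ ∑ j ∈ Finset.Ico k n, β j (prefixOf gs j) := by
  intro n gs hrg hI k hk
  have h := hshoot (gs 0) (hI 0 (Nat.zero_le n)).1 (hI 0 (Nat.zero_le n)).2 k n hk
  have hcongr : ∑ j ∈ Finset.Ico k n, β j (clampPrefix β γ j (gs 0)) = ∑ j ∈ Finset.Ico k n, β j (prefixOf gs j) :=
    Finset.sum_congr rfl fun j hj => by rw [(Y_eq_of_run hrg hI j (Finset.mem_Ico.mp hj).2.le).2]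
  rwa [hcongr] at h

/-- … so «(PS) along shooting trajectories» + continuity + the upper bound give the END binder too (g1-plan-2's named intermediate currency,
now a theorem; strictly between :497's realised runs and :593's all histories). [cite: Balaban1987RG1, Thm 2 p.259] -/
theorem endpointExistence_of_shootingPS {C : B12.Construction} {β : HBeta} (hgen : ForwardGenerated C β)
    {γ₀ M β' : ℝ} (hγ₀ : 0 < γ₀) (hM : 0 ≤ M) (hβ' : 0 ≤ β') (hcont : BetaContH γ₀ β) (hhi : BetaUpperH β' γ₀ β)
    (hshoot : ∀ g₀ : ℝ, 0 < g₀ → g₀ ≤ γ₀ → ∀ k n, k ≤ n → -M ≤ ∑ j ∈ Finset.Ico k n, β j (clampPrefix β γ₀ j g₀)) :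
    EndpointExistence C :=
  endpointExistence_of_runwisePS hgen hγ₀ hM hβ' hcont hhi (runwisePS_of_shootingPS hshoot)

/-- RUN-WISE NECESSITY in the same class, for comparison (the tree's :485 `partialSums_lower_of_run`, restated with the window's own endpoint):
along EVERY in-interval solution of (0.20), `Σ_{j∈[k,n)} β_j = 1∕g_k² − 1∕g_n² ≥ 1∕γ² − 1∕g_n²`.  The sufficiency above asks `≥ −M` with `M`
uniform; necessity delivers only the endpoint-dependent constant — the residual gap between the two is the constant, not the class of
histories. [cite: Balaban1987RG1, (0.20) p.256] -/
theorem windowSum_eq_of_run {n : ℕ} {gs : ℕ → ℝ} (hrg : RGEqH n β gs) (hI : Step.InInterval γ n gs) (k : ℕ) (hk : k ≤ n) :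
    ∑ j ∈ Finset.Ico k n, β j (prefixOf gs j) = 1 / (gs k) ^ 2 - 1 / (gs n) ^ 2 ∧
      1 / γ ^ 2 - 1 / (gs n) ^ 2 ≤ ∑ j ∈ Finset.Ico k n, β j (prefixOf gs j) := by
  have ht := inv_sq_telescopeH hrg hk le_rfl
  have hk' : 1 / γ ^ 2 ≤ 1 / (gs k) ^ 2 :=
    one_div_le_one_div_of_le (pow_pos (hI k hk).1 2) (pow_le_pow_left₀ (hI k hk).1.le (hI k hk).2 2)
  constructor <;> linarith

/-! ## §2 Bounds on the RUNNING CONE propagate along in-interval runs of (0.20) -/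

/-- **CONE BOUNDS PROPAGATE ALONG RUNS.**  Hypothesis (the INDUCTIVE form of Theorem 2's β-input): whenever a history `g_0,…,g_k ∈ ]0,γ]`
ALREADY obeys the two-sided running `b ≤ 1∕g_j² − 1∕g_{j+1}² ≤ β′` for all `j < k` (the discrete (0.31) up to `k`), then
`b ≤ β_{k+1}(g_0,…,g_k) ≤ β′`.  Conclusion: along every solution of (0.20) that stays in `]0,γ]` up to `n`, `b ≤ β_{j+1}(g_0,…,g_j) ≤ β′` for
EVERY `j ≤ n` — the run's own (0.20) feeds the induction.  (The tree's `BetaLowerH b γ β ∧ BetaUpperH β′ γ β` is the case where the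
premise of the hypothesis is dropped.) [cite: Balaban1987RG1, (0.20) p.256 and (0.31) p.259] -/
theorem coneBounds_along_run {b β' : ℝ}
    (hcone : ∀ (k : ℕ) (gs : ℕ → ℝ), (∀ i, i ≤ k → 0 < gs i ∧ gs i ≤ γ) →
      (∀ j, j < k → b ≤ 1 / (gs j) ^ 2 - 1 / (gs (j + 1)) ^ 2 ∧ 1 / (gs j) ^ 2 - 1 / (gs (j + 1)) ^ 2 ≤ β') →
      b ≤ β k (prefixOf gs k) ∧ β k (prefixOf gs k) ≤ β')
    {n : ℕ} {gs : ℕ → ℝ} (hrg : RGEqH n β gs) (hI : Step.InInterval γ n gs) :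
    ∀ j, j ≤ n → b ≤ β j (prefixOf gs j) ∧ β j (prefixOf gs j) ≤ β' := by
  intro j
  induction j using Nat.strong_induction_on with
  | _ j ih =>
    intro hj
    refine hcone j gs (fun i hi => hI i (hi.trans hj)) fun j' hj' => ?_
    have hb := ih j' hj' (hj'.le.trans hj)
    have hstep : 1 / (gs j') ^ 2 - 1 / (gs (j' + 1)) ^ 2 = β j' (prefixOf gs j') := by
      rw [hrg j' (lt_of_lt_of_le hj' hj)]; ring
    rw [hstep]
    exact hb

/-- Cone bounds at level `γ₀` restrict to every level `γ ≤ γ₀` (histories in `]0,γ]` are histories in `]0,γ₀]`). [folklore] -/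
theorem coneBounds_mono {b β' γ₀ : ℝ} (hγ : γ ≤ γ₀)
    (hcone : ∀ (k : ℕ) (gs : ℕ → ℝ), (∀ i, i ≤ k → 0 < gs i ∧ gs i ≤ γ₀) →
      (∀ j, j < k → b ≤ 1 / (gs j) ^ 2 - 1 / (gs (j + 1)) ^ 2 ∧ 1 / (gs j) ^ 2 - 1 / (gs (j + 1)) ^ 2 ≤ β') →
      b ≤ β k (prefixOf gs k) ∧ β k (prefixOf gs k) ≤ β') :
    ∀ (k : ℕ) (gs : ℕ → ℝ), (∀ i, i ≤ k → 0 < gs i ∧ gs i ≤ γ) →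
      (∀ j, j < k → b ≤ 1 / (gs j) ^ 2 - 1 / (gs (j + 1)) ^ 2 ∧ 1 / (gs j) ^ 2 - 1 / (gs (j + 1)) ^ 2 ≤ β') →
      b ≤ β k (prefixOf gs k) ∧ β k (prefixOf gs k) ≤ β' :=
  fun k gs hgs hrun => hcone k gs (fun i hi => ⟨(hgs i hi).1, (hgs i hi).2.trans hγ⟩) hrun

/-- Box bounds are cone bounds (premise dropped): the tree's hypotheses `BetaLowerH b γ β ∧ BetaUpperH β′ γ β` imply the cone form — so
`FlowStepRuns.thm2Printed_of_boxBoundsH` (:211) is `thm2Printed_of_coneBoundsH` below composed with this lemma (the case «cone := box»; the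
tree's statement is not restated here). [folklore] -/
theorem coneBounds_of_boxBounds {b β' : ℝ} (hlo : BetaLowerH b γ β) (hhi : BetaUpperH β' γ β) :
    ∀ (k : ℕ) (gs : ℕ → ℝ), (∀ i, i ≤ k → 0 < gs i ∧ gs i ≤ γ) →
      (∀ j, j < k → b ≤ 1 / (gs j) ^ 2 - 1 / (gs (j + 1)) ^ 2 ∧ 1 / (gs j) ^ 2 - 1 / (gs (j + 1)) ^ 2 ≤ β') →
      b ≤ β k (prefixOf gs k) ∧ β k (prefixOf gs k) ≤ β' := by
  intro k gs hgs _
  have hmem : prefixOf gs k ∈ Box γ k := mem_box.mpr fun i => hgs i (Nat.lt_succ_iff.mp i.isLt)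
  exact ⟨hlo k _ hmem, hhi k _ hmem⟩

/-! ## §3 Theorem 2 (runs ending at `g` with the discrete (0.31)) from bounds on the running cone only -/

/-- THE SEED UNDER CONE BOUNDS.  With `0 ≤ b ≤ β′`, bounds on the running cone at level `γ` and `0 < g ≤ γ`: the trial coupling
`x_s = (1∕g² + β′K)^{−1∕2}` shoots WITHOUT clamping up to `K` with `Y_k(x_s) ≥ 1∕g² + β′(K − k)` — by induction on `k`, the trajectory so far
being an in-interval run, along which `β ≤ β′` by `coneBounds_along_run`. [folklore] -/
theorem seed_of_coneBounds (hγ : 0 < γ) {b β' : ℝ} (hb : 0 ≤ b) (hbβ' : b ≤ β')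
    (hcone : ∀ (k : ℕ) (gs : ℕ → ℝ), (∀ i, i ≤ k → 0 < gs i ∧ gs i ≤ γ) →
      (∀ j, j < k → b ≤ 1 / (gs j) ^ 2 - 1 / (gs (j + 1)) ^ 2 ∧ 1 / (gs j) ^ 2 - 1 / (gs (j + 1)) ^ 2 ≤ β') →
      b ≤ β k (prefixOf gs k) ∧ β k (prefixOf gs k) ≤ β')
    (K : ℕ) {g : ℝ} (hg : 0 < g) (hgγ : g ≤ γ) :
    ∃ xs : ℝ, 0 < xs ∧ xs ≤ g ∧ (∀ k, k ≤ K → 1 / γ ^ 2 ≤ Y β γ k xs) ∧ 1 / g ^ 2 ≤ Y β γ K xs := by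
  have hβ' : 0 ≤ β' := hb.trans hbβ'
  have hγg : 1 / γ ^ 2 ≤ 1 / g ^ 2 := one_div_le_one_div_of_le (by positivity) (pow_le_pow_left₀ hg.le hgγ 2)
  set A : ℝ := 1 / g ^ 2 + β' * K with hA
  have hApos : 0 < A := by positivity
  set xs : ℝ := 1 / Real.sqrt A with hxs
  have hxs_pos : 0 < xs := by positivity
  have hxs_sq : 1 / xs ^ 2 = A := by rw [hxs, div_pow, one_pow, Real.sq_sqrt hApos.le, one_div_one_div]
  have hxs_le_g : xs ≤ g := by
    have h1 : 1 / g ^ 2 ≤ 1 / xs ^ 2 := by rw [hxs_sq, hA]; linarith [mul_nonneg hβ' (Nat.cast_nonneg K)]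
    have h2 : xs ^ 2 ≤ g ^ 2 := by rwa [one_div_le_one_div (by positivity) (by positivity)] at h1
    nlinarith [hxs_pos, hg]
  -- induction: survival up to `k` and the linear lower bound at `k`
  have key : ∀ k, k ≤ K → (∀ i, i ≤ k → 1 / γ ^ 2 ≤ Y β γ i xs) ∧ 1 / g ^ 2 + β' * ((K : ℝ) - k) ≤ Y β γ k xs := by
    intro k
    induction k with
    | zero =>
      intro _
      have h0 : 1 / g ^ 2 + β' * ((K : ℝ) - (0 : ℕ)) ≤ Y β γ 0 xs := by
        rw [Y_zero, hxs_sq, hA]; push_cast; linarith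
      refine ⟨fun i hi => ?_, h0⟩
      obtain rfl := Nat.le_zero.mp hi
      exact hγg.trans (le_trans (by nlinarith [mul_nonneg hβ' (Nat.cast_nonneg K)]) h0)
    | succ k ih =>
      intro hk
      obtain ⟨hsurv, hlow⟩ := ih (Nat.le_of_succ_le hk)
      -- the trajectory up to `k` is an in-interval run; the cone gives `β_k ≤ β′` along it
      have hrun : RGEqH k β (fun i => gClamp γ (Y β γ i xs)) := rgEqH_shoot_of_survives hγ hsurv
      have hbk := (coneBounds_along_run hcone hrun (inInterval_shoot hγ k xs) k le_rfl).2
      have hstep : Y β γ (k + 1) xs = Y β γ k xs - β k (prefixOf (fun i => gClamp γ (Y β γ i xs)) k) := by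
        rw [Y_succ' k xs]; rfl
      have hlow' : 1 / g ^ 2 + β' * ((K : ℝ) - (k + 1 : ℕ)) ≤ Y β γ (k + 1) xs := by
        rw [hstep]; push_cast at hlow ⊢; linarith
      refine ⟨fun i hi => ?_, hlow'⟩
      rcases Nat.lt_or_eq_of_le hi with hlt | rfl
      · exact hsurv i (Nat.lt_succ_iff.mp hlt)
      · have hKk : (0 : ℝ) ≤ (K : ℝ) - (k + 1 : ℕ) := by
          have : ((k + 1 : ℕ) : ℝ) ≤ K := by exact_mod_cast hk
          linarith
        exact hγg.trans (le_trans (by nlinarith [mul_nonneg hβ' hKk]) hlow')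
  exact ⟨xs, hxs_pos, hxs_le_g, (key K le_rfl).1, by
    have h := (key K le_rfl).2; simp only [sub_self, mul_zero, add_zero] at h; exact h⟩

/-- **RUNS IN THEOREM 2's REGIME FROM CONE BOUNDS.**  `0 ≤ b ≤ β′`, `β` jointly continuous on the boxes `]0,γ]^{k+1}`, and `b ≤ β_{k+1} ≤ β′`
asked ONLY on the running cone (histories in `]0,γ]` already obeying `b ≤ 1∕g_j² − 1∕g_{j+1}² ≤ β′`, `j < k`).  Then for every `K` and every
`g ∈ ]0,γ]` some bare coupling gives a solution of (0.20) in `]0,γ]` ending at `g_K = g`, non-decreasing, with the discrete (0.31)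
`1∕g² + b(K−k) ≤ 1∕g_k² ≤ 1∕g² + β′(K−k)`.  = `FlowStep.couplingTrajectory_exists_hist` with its box bounds weakened to cone bounds; proof by the
shooting dichotomy (the touching run would have `β ≥ b ≥ 0` along it, so could not end below `g`).  A REDUCTION; the cone bounds and the
continuity are located unprinted inputs. [cite: Balaban1987RG1, Thm 2 (0.31) p.259] -/
theorem couplingTrajectory_exists_of_coneBounds (β : HBeta) (hγ : 0 < γ) {b β' : ℝ} (hb : 0 ≤ b) (hbβ' : b ≤ β')
    (hcont : BetaContH γ β)
    (hcone : ∀ (k : ℕ) (gs : ℕ → ℝ), (∀ i, i ≤ k → 0 < gs i ∧ gs i ≤ γ) →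
      (∀ j, j < k → b ≤ 1 / (gs j) ^ 2 - 1 / (gs (j + 1)) ^ 2 ∧ 1 / (gs j) ^ 2 - 1 / (gs (j + 1)) ^ 2 ≤ β') →
      b ≤ β k (prefixOf gs k) ∧ β k (prefixOf gs k) ≤ β') :
    ∀ (K : ℕ) (g : ℝ), 0 < g → g ≤ γ →
      ∃ gs : ℕ → ℝ, gs K = g ∧ RGEqH K β gs ∧ Step.InInterval γ K gs ∧ Step.Discrete031 b β' K g gs ∧
        ∀ k, k < K → gs k ≤ gs (k + 1) := by
  intro K g hg hgγ
  obtain ⟨xs, hxs, hxsg, hsv, hendK⟩ := seed_of_coneBounds hγ hb hbβ' hcone K hg hgγ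
  rcases shooting_dichotomy hγ hcont hxs (hxsg.trans hgγ) ⟨hsv, hendK⟩ with
    ⟨x, -, -, hsurv, hY⟩ | ⟨x, -, -, hsurv, hlt, k, hk, hYk⟩
  · set gs : ℕ → ℝ := fun k => gClamp γ (Y β γ k x) with hgsdef
    have hrg : RGEqH K β gs := rgEqH_shoot_of_survives hγ hsurv
    have hI : Step.InInterval γ K gs := inInterval_shoot hγ K x
    have hK : gs K = g := shoot_eq_of_Y_eq hg hY (hsurv K le_rfl)
    have hbds := coneBounds_along_run hcone hrg hI
    refine ⟨gs, hK, hrg, hI, ?_, fun k hk => ?_⟩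
    · have hD := discrete031_of_trajBounds hrg (fun j hj => (hbds j hj.le).1) (fun j hj => (hbds j hj.le).2)
      rwa [hK] at hD
    · -- non-decreasing: `1∕g_k² − 1∕g_{k+1}² = β_k ≥ b ≥ 0`
      have hstep : 1 / (gs k) ^ 2 = 1 / (gs (k + 1)) ^ 2 + β k (prefixOf gs k) := hrg k hk
      have hβk : 0 ≤ β k (prefixOf gs k) := hb.trans (hbds k hk.le).1
      have h1 : 1 / (gs (k + 1)) ^ 2 ≤ 1 / (gs k) ^ 2 := by linarith
      have hp : 0 < gs (k + 1) := (hI (k + 1) hk).1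
      have hq : 0 < gs k := (hI k hk.le).1
      have h2 : (gs k) ^ 2 ≤ (gs (k + 1)) ^ 2 := by rwa [one_div_le_one_div (by positivity) (by positivity)] at h1
      nlinarith
  · exfalso
    set gs : ℕ → ℝ := fun k => gClamp γ (Y β γ k x) with hgsdef
    have hrg : RGEqH K β gs := rgEqH_shoot_of_survives hγ hsurv
    have hI : Step.InInterval γ K gs := inInterval_shoot hγ K x
    have hbds := coneBounds_along_run hcone hrg hI
    -- window sum from the touch: `≥ 0` by the cone, `= 1∕γ² − Y_K(x) < 1∕γ² − 1∕g² ≤ 0` by the dichotomy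
    have hsum : ∑ j ∈ Finset.Ico k K, β j (prefixOf gs j) = 1 / γ ^ 2 - Y β γ K x := by
      rw [hgsdef, windowSum_shoot k K hk x, hYk]
    have hnonneg : 0 ≤ ∑ j ∈ Finset.Ico k K, β j (prefixOf gs j) :=
      Finset.sum_nonneg fun j hj => hb.trans (hbds j (Finset.mem_Ico.mp hj).2.le).1
    have hγg : 1 / γ ^ 2 ≤ 1 / g ^ 2 := one_div_le_one_div_of_le (by positivity) (pow_le_pow_left₀ hg.le hgγ 2)
    linarith

/-- **Runs in Theorem 2's regime for a forward-generated CONSTRUCTION, from cone bounds** (= `FlowStepRuns.regimeRun_exists` with box bounds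
weakened to cone bounds at level `γ₀`): for every `m`, `γ ≤ γ₀`, `g ∈ ]0,γ]`, `K`, a bare coupling whose run of `C` stays in `]0,γ]`, ends at
`g_K = g`, solves (0.20), obeys the discrete (0.31) and is non-decreasing. [cite: Balaban1987RG1, Thm 2 (0.31) p.259 and (0.18)–(0.20) pp.255–256] -/
theorem regimeRun_exists_of_coneBounds {C : B12.Construction} {β : HBeta} (hgen : ForwardGenerated C β) {γ₀ b β' : ℝ}
    (hb : 0 ≤ b) (hbβ' : b ≤ β') (hcont : BetaContH γ₀ β)
    (hcone : ∀ (k : ℕ) (gs : ℕ → ℝ), (∀ i, i ≤ k → 0 < gs i ∧ gs i ≤ γ₀) →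
      (∀ j, j < k → b ≤ 1 / (gs j) ^ 2 - 1 / (gs (j + 1)) ^ 2 ∧ 1 / (gs j) ^ 2 - 1 / (gs (j + 1)) ^ 2 ≤ β') →
      b ≤ β k (prefixOf gs k) ∧ β k (prefixOf gs k) ≤ β')
    (m : ℕ) {γ : ℝ} (hγ : 0 < γ) (hγle : γ ≤ γ₀) {g : ℝ} (hg : 0 < g) (hgγ : g ≤ γ) (K : ℕ) :
    ∃ g0 : ℝ, (C ⟨K, m, g0⟩).flow.InInterval γ K ∧ (C ⟨K, m, g0⟩).flow.g K = g ∧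
      RGEqH K β (C ⟨K, m, g0⟩).flow.g ∧ Step.Discrete031 b β' K g (C ⟨K, m, g0⟩).flow.g ∧
        ∀ k, k < K → (C ⟨K, m, g0⟩).flow.g k ≤ (C ⟨K, m, g0⟩).flow.g (k + 1) := by
  have hcont' : BetaContH γ β := fun k => (hcont k).mono (box_mono hγle k)
  obtain ⟨gs, hgsK, hrg, hI, hD, hmono⟩ :=
    couplingTrajectory_exists_of_coneBounds β hγ hb hbβ' hcont' (coneBounds_mono hγle hcone) K g hg hgγ
  have heq : ∀ k, k ≤ K → (C ⟨K, m, gs 0⟩).flow.g k = gs k :=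
    flow_eq_of_rgEqH (C ⟨K, m, gs 0⟩).flow β K (fun k hk => hgen.2 ⟨K, m, gs 0⟩ k hk)
      (hgen.1 ⟨K, m, gs 0⟩) hrg (fun k hk => (hI k hk).1)
  have hpre : ∀ k, k ≤ K → prefixOf (C ⟨K, m, gs 0⟩).flow.g k = prefixOf gs k := by
    intro k hk
    funext j
    simp [prefixOf, heq j ((Nat.lt_succ_iff.mp j.isLt).trans hk)]
  refine ⟨gs 0, fun k hk => ?_, ?_, fun k hk => ?_, fun k hk => ?_, fun k hk => ?_⟩
  · rw [heq k hk]; exact hI k hk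
  · rw [heq K le_rfl]; exact hgsK
  · rw [heq k hk.le, heq (k + 1) hk, hpre k hk.le]; exact hrg k hk
  · rw [heq k hk]; exact hD k hk
  · rw [heq k hk.le, heq (k + 1) hk]; exact hmono k hk

/-- **`B12.Thm2Printed C L` (THEOREM 2 AS PRINTED, incl. (0.31)) FROM CONE BOUNDS WITH `b > 0`** — joint continuity on the boxes `]0,γ₀]^{k+1}`
and `0 < b ≤ β_{k+1}(g_0,…,g_k) ≤ β′` asked ONLY for histories already obeying the discrete (0.31) up to `k`; (0.31) constants `β = b∕log L`,
`β′∕log L`.  = `FlowStepRuns.thm2Printed_of_boxBoundsH` with its box bounds weakened to the running cone: the INDUCTIVE form of the located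
unprinted input.  A REDUCTION, not a proof of Theorem 2. [cite: Balaban1987RG1, Thm 2 (0.31) p.259] -/
theorem thm2Printed_of_coneBoundsH {C : B12.Construction} {β : HBeta} (hgen : ForwardGenerated C β)
    {L γ₀ b β' : ℝ} (hL : 1 < L) (hγ₀ : 0 < γ₀) (hb : 0 < b) (hbβ' : b ≤ β') (hcont : BetaContH γ₀ β)
    (hcone : ∀ (k : ℕ) (gs : ℕ → ℝ), (∀ i, i ≤ k → 0 < gs i ∧ gs i ≤ γ₀) →
      (∀ j, j < k → b ≤ 1 / (gs j) ^ 2 - 1 / (gs (j + 1)) ^ 2 ∧ 1 / (gs j) ^ 2 - 1 / (gs (j + 1)) ^ 2 ≤ β') →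
      b ≤ β k (prefixOf gs k) ∧ β k (prefixOf gs k) ≤ β') :
    B12.Thm2Printed C L := by
  intro m
  refine ⟨γ₀, hγ₀, fun γ hγ hγle => ⟨γ, hγ, fun g hg hgγ => ?_⟩⟩
  have hlog : 0 < Real.log L := Real.log_pos hL
  refine ⟨b / Real.log L, β' / Real.log L, div_pos hb hlog, div_le_div_of_nonneg_right hbβ' hlog.le, fun K => ?_⟩
  obtain ⟨g0, hI, hK, -, hD, -⟩ := regimeRun_exists_of_coneBounds hgen hb.le hbβ' hcont hcone m hγ hγle hg hgγ K
  refine ⟨g0, hI, hK, fun k hk => ?_⟩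
  rw [coeff_logL b L _ hL, coeff_logL β' L _ hL]
  exact hD k hk

/-- **`DagBinding.EndpointExistence` FROM CONE BOUNDS WITH `b = 0`**, with `g⋆ = γ`: the sign `0 ≤ β_{k+1}` and the ceiling `β_{k+1} ≤ β′` asked
ONLY on histories in `]0,γ₀]` already obeying `0 ≤ 1∕g_j² − 1∕g_{j+1}² ≤ β′` (non-decreasing with bounded steps), + continuity on the boxes
⟹ for every `m`, `γ ≤ γ₀`, EVERY `g ∈ ]0,γ]` and every `K` a run of `C` in `]0,γ]` with `g_K = g`. [cite: Balaban1987RG1, Thm 2 p.259] -/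
theorem endpointExistence_of_coneSign {C : B12.Construction} {β : HBeta} (hgen : ForwardGenerated C β) {γ₀ β' : ℝ}
    (hγ₀ : 0 < γ₀) (hβ' : 0 ≤ β') (hcont : BetaContH γ₀ β)
    (hcone : ∀ (k : ℕ) (gs : ℕ → ℝ), (∀ i, i ≤ k → 0 < gs i ∧ gs i ≤ γ₀) →
      (∀ j, j < k → 0 ≤ 1 / (gs j) ^ 2 - 1 / (gs (j + 1)) ^ 2 ∧ 1 / (gs j) ^ 2 - 1 / (gs (j + 1)) ^ 2 ≤ β') →
      0 ≤ β k (prefixOf gs k) ∧ β k (prefixOf gs k) ≤ β') :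
    EndpointExistence C := by
  intro m
  refine ⟨γ₀, hγ₀, fun γ hγ hγle => ⟨γ, hγ, fun g hg hgγ K => ?_⟩⟩
  obtain ⟨g0, hI, hK, -⟩ := regimeRun_exists_of_coneBounds hgen le_rfl hβ' hcont hcone m hγ hγle hg hgγ K
  exact ⟨g0, hI, hK⟩

/-! ## §4 The SIGN on NON-DECREASING histories only -/

/-- **THE END BINDER FROM THE SIGN ON NON-DECREASING HISTORIES.**  `β` jointly continuous and `≤ β′` on the boxes `]0,γ₀]^{k+1}` (printed,
p. 264), and `0 ≤ β_{k+1}(g_0,…,g_k)` asked ONLY where `g_0 ≤ g_1 ≤ … ≤ g_k` (all in `]0,γ₀]`) ⟹ `EndpointExistence C` with `g⋆ = γ` for every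
construction generated forward by (0.20) with `β`.  (A history in the `b = 0` running cone is non-decreasing, so this is `endpointExistence_of_coneSign`;
every in-interval run is then non-decreasing by `couplingTrajectory_exists_of_coneBounds`.)  Versus `DagBinding.endpointExistence_of_forwardGenerated`
∕ `FlowStepRuns.regimeRun_exists` (`b = 0`), which ask the sign on the WHOLE box. [cite: Balaban1987RG1, Thm 2 p.259] -/
theorem endpointExistence_of_monotoneSign {C : B12.Construction} {β : HBeta} (hgen : ForwardGenerated C β) {γ₀ β' : ℝ}
    (hγ₀ : 0 < γ₀) (hβ' : 0 ≤ β') (hcont : BetaContH γ₀ β) (hhi : BetaUpperH β' γ₀ β)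
    (hsign : ∀ (k : ℕ) (gs : ℕ → ℝ), (∀ i, i ≤ k → 0 < gs i ∧ gs i ≤ γ₀) →
      (∀ i j, i ≤ j → j ≤ k → gs i ≤ gs j) → 0 ≤ β k (prefixOf gs k)) :
    EndpointExistence C := by
  refine endpointExistence_of_coneSign hgen hγ₀ hβ' hcont fun k gs hgs hrun => ?_
  have hmem : prefixOf gs k ∈ Box γ₀ k := mem_box.mpr fun i => hgs i (Nat.lt_succ_iff.mp i.isLt)
  refine ⟨hsign k gs hgs ?_, hhi k _ hmem⟩
  -- the running cone with `b = 0` consists of non-decreasing histories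
  have hstep : ∀ j, j < k → gs j ≤ gs (j + 1) := by
    intro j hj
    have h1 : 1 / (gs (j + 1)) ^ 2 ≤ 1 / (gs j) ^ 2 := by linarith [(hrun j hj).1]
    have hp : 0 < gs (j + 1) := (hgs (j + 1) hj).1
    have hq : 0 < gs j := (hgs j hj.le).1
    have h2 : (gs j) ^ 2 ≤ (gs (j + 1)) ^ 2 := by rwa [one_div_le_one_div (by positivity) (by positivity)] at h1
    nlinarith
  intro i j hij hjk
  induction j, hij using Nat.le_induction with
  | base => exact le_rfl
  | succ j hij ih => exact (ih (Nat.le_of_succ_le hjk)).trans (hstep j (Nat.lt_of_succ_le hjk))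

end

end Summit.QuantumFields.BalabanUV.Gaps.EndRunwiseCone
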